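import Summits.Schanuel.Schanuel.Theorems.RootDecomp1BMovingZero15
import Literature.Analysis.Complex.AbhyankarJungAnalytic
import Literature.Analysis.Complex.AnalyticCover

/-!
# RootDecomp1BMovingZero — lens 4, generation 38 «CURVE SELECTION UNCONDITIONAL» (lane B-R24 (a)): the T-fact binder `CurveSelection` of part 09 DISCHARGED by a sorry-free proof BY NAME (`curveSelection_holds`) via the tree SCV library (Weierstrass box, discriminant roots) + the tree's analytic Abhyankar–Jung (Puiseux) theorem; T″ modulo Ax only; the (1|ρ) cell modulo {Ax, IsolatedPointBound} + the measures — continuation (RootDecomp1BMovingZero16): §0 helpers + §1 Weierstrass box (namespace CurveSel)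

(lens-4 g38 HOME kernel CurveSelectionDischarge.lean 576f8ec8…, 688 l, imports Literature AbhyankarJungAnalytic + AnalyticCover + tree MovingZero15; CLAIM L2013, CHECKLIST B-g38 L2015, NODE L2026 / REQUEST L2027 / RESULT L2028, critic VERDICT L2031 (crit g8: CLEARED — THEOREM ×1; lens-4 tally THEOREM ×5 + CELL ×2; PORT GO 16/17, `--supports stmt-Schanuel-24622`, kind proof); port by census-1 gen 17 as `RootDecomp1BMovingZero16`–`17`: 16 = §0 helpers + §1 Weierstrass box (distinct slice roots, sheets, reduced polynomial) in `namespace CurveSel`; 17 = §2 the engine at the origin + §3 reductions (a line with F ≢ 0, affine frame) + §4 THE DISCHARGE `curveSelection_holds : CurveSelection` + §5 read-outs `isolatedIntersectionGeneral_of_ax`, `movingZeroApprox_of_two_facts : AxRankBoundLaurent → IsolatedPointBound → ∀ ρ, MovingZeroApprox ρ`, `four_le_polarDeg_one_of_two_facts` (+ swap / hyper / rhoT).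
PORT EDITS: the axiom-guard section, unused `import HarnessLib` and the `dupNamespace` option dropped; statements and proofs verbatim (theorem type = the tree def BY NAME). `--supports stmt-Schanuel-24622`; no census credit carried; rung 0.)
-/

open Complex Filter Topology Metric Set Polynomial
open Literature.Analysis.Complex.SCV (WeierstrassData sliceRoots rootMultiset exists_weierstrassData
  mem_rootMultiset_iff)

namespace Summit.Schanuel.Schanuel.Theorems.RootDecomp1BMovingZero

/-!
# RootDecomp1BMovingZero — lens 4, generation 38 «CURVE SELECTION UNCONDITIONAL»: the named print input
# `CurveSelection` (FACT T-ii, part 09 l.48) of the moving-zero cell DISCHARGED by a sorry-free, hypothesis-free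
# proof of the SAME statement BY NAME (lane B-R24 (a), critic VERDICTs L1957/L2007; CLAIM L2013; ACK + CHECKLIST
# B-g38 L2015)

HOME kernel of lens 4, g38.  Imports ONLY accepted·committed tree modules: the cell's part
`RootDecomp1BMovingZero15` (transitively 01–14; the `def` discharged here lives in part 09, l.48, and is used BY
NAME — no copy, no primed variant, no restatement) and the tree's PROVED several-complex-variables library
`Literature.Analysis.Complex.AnalyticCover` (Weierstrass data of a holomorphic function, the discriminant-type
function `μ`, holomorphic root sheets — Chirka 1989 §1.3–§1.5 formalised; transitively `WeierstrassPreparation`)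
and `Literature.Analysis.Complex.AbhyankarJungAnalytic` (the analytic Abhyankar–Jung theorem, Parusiński–Rond 2012
Prop. 2.1, formalised).  0 `sorry`, no `def`, no new named fact, no `instance` / `notation`, no heartbeat option;
`set_option` = `linter.dupNamespace false` only (HOME guard); axioms `propext, Classical.choice, Quot.sound` (§6).

## What is proved (all in `namespace Summit.Schanuel.Schanuel.Theorems.RootDecomp1BMovingZero`)

* §4 **`curveSelection_holds : CurveSelection`** — the tree `def` of part 09 l.48 BY NAME:
  `∀ Φ p, AnalyticAt ℂ Φ p → Φ p = 0 → (∃ᶠ w in 𝓝[≠] p, Φ w = 0) →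
   ∃ γ, AnalyticAt ℂ γ 0 ∧ γ 0 = p ∧ (¬ ∀ᶠ s in 𝓝 0, γ s = p) ∧ ∀ᶠ s in 𝓝 0, Φ (γ s) = 0`.
* §5 READ-OUTS (INSTANTIATIONS of the tree consumers of parts 10 / 15 at `curveSelection_holds`; bookkeeping, no
  second credit): `isolatedIntersectionGeneral_of_ax (hAx : AxRankBoundLaurent) : IsolatedIntersectionGeneral`
  (T″ modulo the tree Ax statement only), `isolatedIntersection_of_ax`,
  `movingZeroApprox_of_two_facts (hAx) (hB : IsolatedPointBound) (ρ : ℝ) : MovingZeroApprox ρ`,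
  `four_le_polarDeg_one_of_two_facts (hLW : LWMeasure) (hX : ExplicitRatExpApprox) (hAx) (hB) (hρ : LiouvilleOrder 8 ρ)`
  (+ `_swap_`, `_hyper_`, `_rhoT_`): the cell X(2) at `(1 | ρ)` modulo FOUR named inputs {`AxRankBoundLaurent`
  (Ax 1971, tree-proved in `Literature/…/AxSchanuelUniv`, carried by name), `IsolatedPointBound`, `LWMeasure`,
  `ExplicitRatExpApprox`}; the moving-zero layer `MovingZeroApprox ρ ∀ ρ` modulo TWO.

## Proof of `curveSelection_holds` (reduced Weierstrass polynomial + analytic Abhyankar–Jung at `d = 1` + pigeonhole)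

(§4) Write `Φ = (Φ₁, Φ₂)`.  If both components vanish identically near `p`, the complex line `s ↦ p + (s, 0)` is the
curve.  Otherwise let `F` be a component with `F ≢ 0` near `p` and `G` the other one (both sub-cases, incl. `G ≡ 0`).
(§3) Some complex line through `p` restricts `F` non-trivially (`exists_line_not_eventually_zero`: else, by the
one-variable identity theorem on every line through `p`, `F ≡ 0` on a ball); a linear automorphism `e` of `ℂ²` with
`e (0, w) = w • v` (`exists_frame`) and the affine chart `L x = p + e x` put that line on the second coordinate axis,
and the three hypotheses / four conclusion clauses are transported along the homeomorphism `L`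
(`Homeomorph.map_punctured_nhds_eq`, `Filter.frequently_map`; `exists_curve_of_pair`).  (§2, at the origin,
`exists_curve_at_zero`) `SCV.exists_weierstrassData` gives a Weierstrass box `ball 0 ε × ball 0 R ⊆ Ω` in which the
slice zeros of `F (z, ·)` in the fibre disc `ball 0 r` form the multiset `sliceRoots F 0 r z`, `0` being the ONLY
zero of `F (0, ·)` in the CLOSED fibre disc.  (§1, `exists_reduced_polynomial`)
`WeierstrassData.exists_discriminant_roots` gives `μ` holomorphic on the base disc, `μ ≢ 0`, off whose zeros the
DISTINCT slice roots are locally the values of pairwise-distinct holomorphic sheets `β₁ … β_s`; `0` is isolated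
among the zeros of `μ` (one-variable identity theorem on the preconnected disc: `μ` eventually `0` at `0` would force
`μ ≡ 0`), so on a punctured disc `D* = ball 0 ε₁ ∖ {0}` the number of distinct roots is locally constant, hence
CONSTANT `= k` (`D*` is preconnected: polar coordinates, `isPreconnected_ball_diff_zero`; `IsPreconnected.constant`).
The REDUCED polynomial `P_z = ∏_{w ∈ distinct roots over z} (X - w)` has coefficients holomorphic on `D*` (locally
signed elementary symmetric polynomials of the sheets — Vieta, `Multiset.prod_X_sub_C_coeff`) and bounded (roots in
`ball 0 r`), so they extend holomorphically across `0` (Riemann: `Complex.differentiableOn_update_limUnder_of_bddAbove`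
on `ball 0 ε₁`); `P_z` is separable for `z ∈ D*` (distinct roots).  (§1, `exists_root_parametrisation`) The tree's
analytic Abhyankar–Jung theorem `AbhyankarJung.exists_roots_pow` at `d = 1` (box `T 0 = ball 0 ε₁`; separability is
demanded only off `0`) gives `q ≥ 1` and `g₁ … g_k` holomorphic on `{s | s^q ∈ ball 0 ε₁}` with
`P_{s^q} = ∏ₗ (X - gₗ s)`; for `s ≠ 0` the `gₗ s` are exactly the distinct slice roots over `s^q`, i.e. ALL zeros of
`F (s^q, ·)` in the fibre disc (`mem_rootMultiset_iff`).  (§2) By continuity `F (0, gₗ 0) = 0` with `‖gₗ 0‖ ≤ r`,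
hence `gₗ 0 = 0`; the curves `γₗ s = (s^q, gₗ s)` are analytic at `0`, `γₗ 0 = 0`, `γₗ s ≠ 0` for `s ≠ 0` (first
coordinate), and `F ∘ γₗ = 0` near `0`.  PIGEONHOLE: if EVERY `G ∘ γₗ` were eventually `≠ 0` on `𝓝[≠] 0`, then
(`Filter.eventually_all`, a uniform radius `δ`) every common zero `(z, w) ≠ 0` of `(F, G)` with `‖z‖ < δ^q`,
`‖w‖ < r` is impossible: `z = 0` forces `w = 0` (closed fibre disc), and `z ≠ 0` gives `z = y^q` with `0 < ‖y‖ < δ`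
(`IsAlgClosed.exists_pow_nat_eq`) and `w = gₗ y` for some `l` (SWEEPING), where `G ≠ 0` — contradicting
non-isolation.  Hence some `G ∘ γₗ` vanishes frequently at `0`, so identically near `0`
(`AnalyticAt.eventually_eq_zero_or_eventually_ne_zero`), and `γ := L ∘ γₗ` is the curve; `¬ ∀ᶠ s, γ s = p` from
`γ s ≠ p ∀ s ≠ 0` and part 09's `not_eventually_eq_nhds`.

References: Chirka, *Complex Analytic Sets* (1989), §1.3–§1.5 (Weierstrass data, discriminant, sheets), §3.5
Prop. 1 p. 47, §6.1 pp. 82–83; Parusiński–Rond, *The Abhyankar–Jung theorem* (J. Algebra 365, 2012) Prop. 2.1;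
D'Angelo (1993) p. 92.  [cite: Chirka1989, §1.5; §3.5 Prop. 1; §6.1] [cite: ParusinskiRond2012, Prop. 2.1]
[cite: DAngeloSCV1993, p. 92] [folklore]
-/

namespace CurveSel

/-! ### §0  One-variable and polynomial helpers -/

/-- The punctured disc `ball 0 ε ∖ {0} ⊆ ℂ` is preconnected: it is the image of the convex set `Ioo 0 ε ×ˢ univ ⊆ ℝ²`
under the polar-coordinate map `(ρ, θ) ↦ ρ e^{iθ}`. [folklore] -/
theorem isPreconnected_ball_diff_zero (ε : ℝ) : IsPreconnected (ball (0 : ℂ) ε \ {0}) := by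
  have hpol : ball (0 : ℂ) ε \ {0} =
      (fun p : ℝ × ℝ => (p.1 : ℂ) * cexp (p.2 * I)) '' (Ioo (0 : ℝ) ε ×ˢ univ) := by
    ext z
    simp only [Set.mem_sdiff, mem_ball, dist_zero_right, mem_singleton_iff, mem_image, mem_prod, mem_Ioo, mem_univ,
      and_true, Prod.exists]
    constructor
    · rintro ⟨hz, hz0⟩
      exact ⟨‖z‖, arg z, ⟨norm_pos_iff.2 hz0, hz⟩, norm_mul_exp_arg_mul_I z⟩
    · rintro ⟨ρ, θ, ⟨hρ0, hρε⟩, rfl⟩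
      have hn : ‖(ρ : ℂ) * cexp (θ * I)‖ = ρ := by
        rw [norm_mul, Complex.norm_exp_ofReal_mul_I, mul_one, Complex.norm_real, Real.norm_eq_abs,
          abs_of_pos hρ0]
      refine ⟨by rw [hn]; exact hρε, fun h => ?_⟩
      rw [h, norm_zero] at hn
      exact hρ0.ne hn
  rw [hpol]
  exact ((convex_Ioo (0 : ℝ) ε).prod convex_univ).isPreconnected.image _ (by fun_prop : Continuous _).continuousOn

/-- Vieta: the coefficients of `∏ᵢ (X - C (f i))` are signed elementary symmetric polynomials of the `f i`.
[folklore] -/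
theorem coeff_prod_X_sub_C_eq {ι : Type*} (s : Finset ι) (f : ι → ℂ) {j : ℕ} (hj : j ≤ s.card) :
    (∏ i ∈ s, (X - C (f i))).coeff j =
      (-1) ^ (s.card - j) * ∑ t ∈ s.powersetCard (s.card - j), ∏ i ∈ t, f i := by
  classical
  rw [Finset.prod_eq_multiset_prod]
  have hmap : Multiset.map (fun i => X - C (f i)) s.val =
      Multiset.map (fun t => X - C t) (Multiset.map f s.val) := by
    rw [Multiset.map_map]; rfl
  rw [hmap, Multiset.prod_X_sub_C_coeff _ (by simpa using hj), Multiset.card_map, Finset.card_val,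
    Finset.esymm_map_val]

/-- `∏ᵢ (X - C (f i))` is monic … [folklore] -/
theorem monic_prod_X_sub_C' {ι : Type*} (s : Finset ι) (f : ι → ℂ) : (∏ i ∈ s, (X - C (f i))).Monic :=
  monic_prod_of_monic _ _ fun i _ => monic_X_sub_C (f i)

/-- … of degree `#s`. [folklore] -/
theorem natDegree_prod_X_sub_C' {ι : Type*} (s : Finset ι) (f : ι → ℂ) :
    (∏ i ∈ s, (X - C (f i))).natDegree = s.card := by
  rw [natDegree_prod_of_monic _ _ fun i _ => monic_X_sub_C (f i)]
  simp

/-- The monic normal form `X ^ k + ∑_{j<k} aⱼ X^j` of `∏ᵢ (X - C (f i))`, `#s = k`. [folklore] -/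
theorem X_pow_add_sum_eq_prod {ι : Type*} (s : Finset ι) (f : ι → ℂ) {k : ℕ} (hk : s.card = k)
    (a : Fin k → ℂ) (ha : ∀ j : Fin k, a j = (∏ i ∈ s, (X - C (f i))).coeff j) :
    X ^ k + ∑ j : Fin k, C (a j) * X ^ (j : ℕ) = ∏ i ∈ s, (X - C (f i)) := by
  have hmon := monic_prod_X_sub_C' s f
  have hnat : (∏ i ∈ s, (X - C (f i))).natDegree = k := by rw [natDegree_prod_X_sub_C', hk]
  conv_rhs => rw [hmon.as_sum, hnat]
  simp_rw [ha]
  exact congrArg _ (Fin.sum_univ_eq_sum_range (fun j => C ((∏ i ∈ s, (X - C (f i))).coeff j) * X ^ j) k)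

/-- Reading off the root SET from a factorisation into linear factors. [folklore] -/
theorem mem_iff_of_prod_X_sub_C_eq {S : Finset ℂ} {k : ℕ} {c : Fin k → ℂ}
    (h : ∏ w ∈ S, (X - C w) = ∏ l, (X - C (c l))) (w : ℂ) : w ∈ S ↔ ∃ l, w = c l := by
  have h1 : w ∈ S ↔ eval w (∏ a ∈ S, (X - C a)) = 0 := by
    rw [eval_prod, Finset.prod_eq_zero_iff]; simp [sub_eq_zero]
  have h2 : (∃ l, w = c l) ↔ eval w (∏ l, (X - C (c l))) = 0 := by
    rw [eval_prod, Finset.prod_eq_zero_iff]; simp [sub_eq_zero]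
  rw [h1, h2, h]

/-- Coefficient bound for `∏_{w ∈ S} (X - w)` with all `‖w‖ ≤ r`. [folklore] -/
theorem norm_coeff_prod_X_sub_C_le (S : Finset ℂ) {r : ℝ} (hS : ∀ w ∈ S, ‖w‖ ≤ r) (j : ℕ) :
    ‖(∏ w ∈ S, (X - C w)).coeff j‖ ≤ (S.card.choose (S.card - j)) * (max 1 r) ^ S.card := by
  have hM : (1 : ℝ) ≤ max 1 r := le_max_left _ _
  by_cases hj : j ≤ S.card
  · have h := coeff_prod_X_sub_C_eq S id hj
    simp only [id] at h
    rw [h, norm_mul, norm_pow, norm_neg, norm_one, one_pow, one_mul]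
    calc ‖∑ t ∈ S.powersetCard (S.card - j), ∏ i ∈ t, i‖
        ≤ ∑ t ∈ S.powersetCard (S.card - j), ‖∏ i ∈ t, i‖ := norm_sum_le _ _
      _ ≤ ∑ t ∈ S.powersetCard (S.card - j), (max 1 r) ^ S.card := by
          refine Finset.sum_le_sum fun t ht => ?_
          have hts : t ⊆ S := (Finset.mem_powersetCard.1 ht).1
          calc ‖∏ i ∈ t, i‖ = ∏ i ∈ t, ‖i‖ := norm_prod _ _
            _ ≤ ∏ _i ∈ t, max 1 r :=
                Finset.prod_le_prod (fun i _ => norm_nonneg i) fun i hi => (hS i (hts hi)).trans (le_max_right _ _)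
            _ = (max 1 r) ^ t.card := Finset.prod_const _
            _ ≤ (max 1 r) ^ S.card := pow_le_pow_right₀ hM (Finset.card_le_card hts)
      _ = (S.card.choose (S.card - j)) * (max 1 r) ^ S.card := by
          rw [Finset.sum_const, Finset.card_powersetCard, nsmul_eq_mul]
  · push Not at hj
    have hdeg : (∏ w ∈ S, (X - C w)).natDegree < j := by
      rw [show (∏ w ∈ S, (X - C w)) = ∏ w ∈ S, (X - C (id w)) from rfl, natDegree_prod_X_sub_C']; exact hj
    rw [coeff_eq_zero_of_natDegree_lt hdeg, norm_zero]
    exact mul_nonneg (Nat.cast_nonneg _) (pow_nonneg (zero_le_one.trans hM) _)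

/-- The coefficients of `∏ᵢ (X - C (βᵢ z))` are holomorphic in `z` when the `βᵢ` are. [folklore] -/
theorem differentiableOn_coeff_prod_X_sub_C {s : ℕ} {β : Fin s → ℂ → ℂ} {U : Set ℂ}
    (hβ : ∀ i, DifferentiableOn ℂ (β i) U) (j : ℕ) :
    DifferentiableOn ℂ (fun z => (∏ i, (X - C (β i z))).coeff j) U := by
  classical
  by_cases hj : j ≤ s
  · have hform : ∀ z, (∏ i, (X - C (β i z))).coeff j =
        (-1) ^ (s - j) * ∑ t ∈ (Finset.univ : Finset (Fin s)).powersetCard (s - j), ∏ i ∈ t, β i z := by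
      intro z
      have h := coeff_prod_X_sub_C_eq (Finset.univ : Finset (Fin s)) (fun i => β i z) (j := j) (by simpa using hj)
      simpa using h
    simp_rw [hform]
    refine (differentiableOn_const _).mul ?_
    have hsum : (fun z => ∑ t ∈ (Finset.univ : Finset (Fin s)).powersetCard (s - j), ∏ i ∈ t, β i z) =
        ∑ t ∈ (Finset.univ : Finset (Fin s)).powersetCard (s - j), fun z => ∏ i ∈ t, β i z := by
      ext z; simp [Finset.sum_apply]
    rw [hsum]
    refine DifferentiableOn.sum fun t _ => ?_
    have hprod : (fun z => ∏ i ∈ t, β i z) = ∏ i ∈ t, β i := by ext z; simp [Finset.prod_apply]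
    rw [hprod]
    exact DifferentiableOn.finsetProd fun i _ => hβ i
  · push Not at hj
    refine (differentiableOn_const (0 : ℂ)).congr fun z _ => ?_
    exact coeff_eq_zero_of_natDegree_lt (by rw [natDegree_prod_X_sub_C']; simpa using hj)

/-! ### §1  Weierstrass box: distinct slice roots, sheets, the reduced polynomial -/

/-- In a Weierstrass box over the base disc `ball 0 ε`, the distinct slice roots over `z` are exactly the zeros of
`F (z, ·)` in the fibre disc. [cite: Chirka1989, §1.3] [folklore] -/
theorem mem_toFinset_sliceRoots {F : ℂ × ℂ → ℂ} {ε r R : ℝ} (hW : WeierstrassData F (ball (0 : ℂ) ε) 0 r R)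
    {z : ℂ} (hz : z ∈ ball (0 : ℂ) ε) (w : ℂ) :
    w ∈ (sliceRoots F 0 r z).toFinset ↔ w ∈ ball (0 : ℂ) r ∧ F (z, w) = 0 := by
  rw [Multiset.mem_toFinset]
  exact mem_rootMultiset_iff (hW.differentiableOn_slice hz) hW.pos hW.lt (hW.ne_zero z hz)

/-- Over a sheet ball, the distinct slice roots are the values of the (pairwise distinct) sheets: the root set is
the image of the sheets, it has exactly `s` elements, and the reduced polynomial factors through the sheets.
[cite: Chirka1989, §1.3, p. 7–8] [folklore] -/
theorem sheet_data {F : ℂ × ℂ → ℂ} {r : ℝ} {z₁ : ℂ} {δ : ℝ} {s : ℕ} {β : Fin s → ℂ → ℂ}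
    (hinj : ∀ z ∈ ball z₁ δ, ∀ i j, i ≠ j → β i z ≠ β j z)
    (hroots : ∀ z ∈ ball z₁ δ, ∀ w, w ∈ sliceRoots F 0 r z ↔ ∃ i, w = β i z) {z : ℂ} (hz : z ∈ ball z₁ δ) :
    (sliceRoots F 0 r z).toFinset.card = s ∧
    ∏ w ∈ (sliceRoots F 0 r z).toFinset, (X - C w) = ∏ i, (X - C (β i z)) := by
  classical
  have hinj' : Function.Injective (fun i => β i z) := fun i j h => by_contra fun hij => hinj z hz i j hij h
  have hset : (sliceRoots F 0 r z).toFinset = Finset.univ.image (fun i => β i z) := by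
    ext w
    simp only [Multiset.mem_toFinset, Finset.mem_image, Finset.mem_univ, true_and, hroots z hz w]
    exact ⟨fun ⟨i, hi⟩ => ⟨i, hi.symm⟩, fun ⟨i, hi⟩ => ⟨i, hi.symm⟩⟩
  refine ⟨?_, ?_⟩
  · rw [hset, Finset.card_image_of_injective _ hinj', Finset.card_univ, Fintype.card_fin]
  · rw [hset, Finset.prod_image fun i _ j _ h => hinj' h]

/-- **The reduced Weierstrass polynomial.**  On some punctured disc `ball 0 ε₁ ∖ {0}` of the base the number `k` of
DISTINCT slice roots is constant, and there are functions `A₀ … A_{k-1}` HOLOMORPHIC ON THE WHOLE DISC `ball 0 ε₁`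
(Riemann extension across `0`) with `X^k + ∑ Aⱼ(z) X^j = ∏_{w ∈ distinct roots over z} (X - w)` for `z ≠ 0`.
[cite: Chirka1989, §1.4–§1.5] [folklore] -/
theorem exists_reduced_polynomial {F : ℂ × ℂ → ℂ} {ε r R : ℝ} (hε : 0 < ε)
    (hW : WeierstrassData F (ball (0 : ℂ) ε) 0 r R) :
    ∃ (ε₁ : ℝ) (k : ℕ) (A : Fin k → ℂ → ℂ), 0 < ε₁ ∧ ε₁ ≤ ε ∧
      (∀ j, DifferentiableOn ℂ (A j) (ball (0 : ℂ) ε₁)) ∧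
      ∀ z ∈ ball (0 : ℂ) ε₁, z ≠ 0 →
        X ^ k + ∑ j : Fin k, C (A j z) * X ^ (j : ℕ) = ∏ w ∈ (sliceRoots F 0 r z).toFinset, (X - C w) := by
  classical
  have hpre : IsPreconnected (ball (0 : ℂ) ε) := (convex_ball _ _).isPreconnected
  -- the discriminant-type function `μ` and the sheets off its zeros
  obtain ⟨μ, hμd, ⟨z₁, hz₁, hμz₁⟩, hsh⟩ := hW.exists_discriminant_roots hpre ⟨0, mem_ball_self hε⟩
  have hμan : AnalyticOnNhd ℂ μ (ball (0 : ℂ) ε) := hμd.analyticOnNhd isOpen_ball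
  -- `0` is isolated among the zeros of `μ` (identity theorem on the preconnected disc, `μ z₁ ≠ 0`)
  have hμev : ∀ᶠ z in 𝓝[≠] (0 : ℂ), μ z ≠ 0 := by
    rcases (hμan 0 (mem_ball_self hε)).eventually_eq_zero_or_eventually_ne_zero with h | h
    · exact absurd (hμan.eqOn_zero_of_preconnected_of_eventuallyEq_zero hpre (mem_ball_self hε) h hz₁) hμz₁
    · exact h
  obtain ⟨ε₀, hε₀, hε₀μ⟩ : ∃ ε₀ > 0, ∀ z ∈ ball (0 : ℂ) ε₀, z ≠ 0 → μ z ≠ 0 := by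
    rw [eventually_nhdsWithin_iff, Metric.eventually_nhds_iff] at hμev
    obtain ⟨ε₀, hε₀, h⟩ := hμev
    exact ⟨ε₀, hε₀, fun z hz hz0 => h (mem_ball.1 hz) hz0⟩
  set ε₁ : ℝ := min ε₀ ε with hε₁_def
  have hε₁ : 0 < ε₁ := lt_min hε₀ hε
  have hε₁ε : ε₁ ≤ ε := min_le_right _ _
  have hD : ∀ z ∈ ball (0 : ℂ) ε₁ \ {0}, z ∈ ball (0 : ℂ) ε ∧ μ z ≠ 0 := fun z hz =>
    ⟨ball_subset_ball hε₁ε hz.1, hε₀μ z (ball_subset_ball (min_le_left _ _) hz.1) hz.2⟩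
  -- the number of distinct roots is locally constant on the punctured disc, hence constant
  have hcont : ContinuousOn (fun z => (sliceRoots F 0 r z).toFinset.card) (ball (0 : ℂ) ε₁ \ {0}) := by
    intro z hz
    obtain ⟨δ, hδ, -, s, β, -, hinj, -, hroots⟩ := hsh z (hD z hz).1 (hD z hz).2
    have hev : (fun _ : ℂ => s) =ᶠ[𝓝 z] fun z' => (sliceRoots F 0 r z').toFinset.card :=
      eventually_of_mem (ball_mem_nhds z hδ) fun z' hz' => ((sheet_data hinj hroots hz').1).symm
    exact ((continuousAt_const : ContinuousAt (fun _ : ℂ => s) z).congr hev).continuousWithinAt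
  set zs : ℂ := ((ε₁ / 2 : ℝ) : ℂ) with hzs_def
  have hzs : zs ∈ ball (0 : ℂ) ε₁ \ {0} := by
    refine ⟨?_, ?_⟩
    · rw [mem_ball_zero_iff, hzs_def, Complex.norm_real, Real.norm_eq_abs, abs_of_pos (half_pos hε₁)]
      exact half_lt_self hε₁
    · rw [mem_singleton_iff, hzs_def, Complex.ofReal_eq_zero]; exact (half_pos hε₁).ne'
  set k : ℕ := (sliceRoots F 0 r zs).toFinset.card with hk_def
  have hk : ∀ z ∈ ball (0 : ℂ) ε₁ \ {0}, (sliceRoots F 0 r z).toFinset.card = k := fun z hz =>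
    (isPreconnected_ball_diff_zero ε₁).constant hcont hz hzs
  -- the coefficients of the reduced polynomial, extended across `0` by Riemann's theorem
  set a₀ : ℕ → ℂ → ℂ := fun j z => (∏ w ∈ (sliceRoots F 0 r z).toFinset, (X - C w)).coeff j with ha₀_def
  set a : ℕ → ℂ → ℂ := fun j => Function.update (a₀ j) 0 (limUnder (𝓝[≠] 0) (a₀ j)) with ha_def
  have hdiff : ∀ j, DifferentiableOn ℂ (a j) (ball (0 : ℂ) ε₁) := by
    intro j
    apply Complex.differentiableOn_update_limUnder_of_bddAbove (ball_mem_nhds _ hε₁)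
    · intro z hz
      obtain ⟨δ, hδ, -, s, β, hβd, hinj, -, hroots⟩ := hsh z (hD z hz).1 (hD z hz).2
      have hloc : DifferentiableOn ℂ (a₀ j) (ball z δ) :=
        (differentiableOn_coeff_prod_X_sub_C hβd j).congr fun z' hz' => by
          simp only [ha₀_def]; rw [(sheet_data hinj hroots hz').2]
      exact (hloc.differentiableAt (ball_mem_nhds z hδ)).differentiableWithinAt
    · refine ⟨(k.choose (k - j)) * (max 1 r) ^ k, ?_⟩
      rintro _ ⟨z, hz, rfl⟩
      have hb := norm_coeff_prod_X_sub_C_le (sliceRoots F 0 r z).toFinset (r := r)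
        (fun w hw => (mem_ball_zero_iff.1 ((mem_toFinset_sliceRoots hW (hD z hz).1 w).1 hw).1).le) j
      rw [hk z hz] at hb
      simpa only [Function.comp, ha₀_def] using hb
  refine ⟨ε₁, k, fun j => a j, hε₁, hε₁ε, fun j => hdiff j, fun z hz hz0 => ?_⟩
  have h := X_pow_add_sum_eq_prod (sliceRoots F 0 r z).toFinset id (hk z ⟨hz, hz0⟩) (fun j => a j z)
    (fun j => by simp only [ha_def, Function.update_of_ne hz0, ha₀_def, id])
  simpa only [id] using h

/-- **Root parametrisation after a base change `z = s^q`** (analytic Abhyankar–Jung, `d = 1`, applied to the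
reduced polynomial): holomorphic `g₁ … g_k` on `{s | s^q ∈ ball 0 ε₁}` whose values at `s ≠ 0` are exactly the
distinct slice roots over `s^q`. [cite: ParusinskiRond2012, Prop. 2.1] [cite: Chirka1989, §6.1] -/
theorem exists_root_parametrisation {F : ℂ × ℂ → ℂ} {ε r R : ℝ} (hε : 0 < ε)
    (hW : WeierstrassData F (ball (0 : ℂ) ε) 0 r R) :
    ∃ (q k : ℕ) (ε₁ : ℝ) (g : Fin k → ℂ → ℂ), 0 < q ∧ 0 < ε₁ ∧ ε₁ ≤ ε ∧
      (∀ l, DifferentiableOn ℂ (g l) {s : ℂ | s ^ q ∈ ball (0 : ℂ) ε₁}) ∧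
      ∀ s : ℂ, s ^ q ∈ ball (0 : ℂ) ε₁ → s ≠ 0 →
        ∀ w, w ∈ (sliceRoots F 0 r (s ^ q)).toFinset ↔ ∃ l, w = g l s := by
  classical
  obtain ⟨ε₁, k, A, hε₁, hε₁ε, hA, hid⟩ := exists_reduced_polynomial hε hW
  obtain ⟨q, hq, f, hf, hfact⟩ := Literature.Analysis.Complex.AbhyankarJung.exists_roots_pow (d := 1) (n := k)
    (T := fun _ => ball (0 : ℂ) ε₁) (fun _ => isOpen_ball) (fun _ => convex_ball _ _)
    (fun _ => isBounded_ball) (fun _ => mem_ball_self hε₁) (A := fun j x => A j (x 0))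
    (fun j => (hA j).comp (differentiable_apply 0).differentiableOn fun x hx => hx 0)
    (by
      intro x hx hx0
      rw [hid (x 0) (hx 0) (hx0 0)]
      exact separable_prod_X_sub_C_iff'.2 fun a _ b _ h => h)
  refine ⟨q, k, ε₁, fun l s => f l (fun _ => s), hq, hε₁, hε₁ε, fun l => ?_, fun s hs hs0 w => ?_⟩
  · exact (hf l).comp (differentiableOn_pi.2 fun _ => differentiableOn_id) fun s hs _ => hs
  · have h := hfact (fun _ => s) (fun _ => hs)
    rw [hid (s ^ q) hs (pow_ne_zero _ hs0)] at h
    exact mem_iff_of_prod_X_sub_C_eq h w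

end CurveSel

end Summit.Schanuel.Schanuel.Theorems.RootDecomp1BMovingZero
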